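import Mathlib

/-!
# `Balaban1983to89.B9Eq343ProfileLetters` — T. Bałaban, *Propagators for lattice gauge theories in a background field*, Commun. Math. Phys. **99** (1985) 389–434
# [Balaban1985BackgroundPropagators] (3.43)–(3.46) p. 398 (smooth cutoffs scaled to the cubes), (3.1) p. 390 (the `η`-lattice): **THE ONE-DIMENSIONAL PROFILE
# LETTERS — a `C^{1,1}` function `g` (`|g′| ≤ L₁`, `g′` `L₂`-Lipschitz) SAMPLED AT SPACING `h` has first differences `≤ L₁·h` and second differences `≤ 2L₂·h²`;
# at `h = 1∕(r·t)` (`t = η⁻¹`, `r` the physical width) the difference QUOTIENTS are t-FREE: `|t(p(k+1) − p(k))| ≤ L₁∕r`, `|t²(2p(k) − p(k+1) − p(k−1))| ≤ 2L₂∕r²` —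
# the profile letters consumed by `B9Eq343ProductCutoffLetters` (and through it the cutoff letters `c∕r`, `c∕r²` of `B9Eq323KatoCutoffCommutator` ∕
# `B9Eq342GradientRowAssembly`)**

statement-level skeleton of published theorems with citation tags; proofs where landed; nothing here is a claim about the Yang–Mills mass gap

CITATION HEADER (lean-in-tree rule).  Audit cell `pub-balaban`, sub-cell `t4`, BINDER row NE9; filed by NE9 crux-team LEAF PROVER 05
(`b2b-balaban-t4-ne9-formalise-leaf-05`, gen 84).  SOURCE READ first-hand in the held text layer [Balaban1985BackgroundPropagators]
(`paper:balaban1985-cmp99-background-propagators`): p. 398 (3.43)–(3.46); p. 390 (3.1).  [folklore] one-variable calculus (the mean value theorem twice); nothing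
printed is a hypothesis; the `[cite: …]` tags are TEXT LOCATIONS.

WHAT IS PROVED (sorry-free; 0 `def`; `import Mathlib` only; [folklore]).  `g g′ : ℝ → ℝ` with `HasDerivAt g (g′ x) x` everywhere.
* **`abs_sub_le_of_deriv_bound`** — `|g′| ≤ L₁` ⟹ `|g(y) − g(x)| ≤ L₁·|y − x|`.
* **`abs_second_difference_le`** — `g′` `L₂`-Lipschitz (`|g′ x − g′ y| ≤ L₂|x − y|`), `0 < h` ⟹ `|g(x + h) − 2g(x) + g(x − h)| ≤ 2L₂·h²` (MVT on `[x, x+h]` and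
  `[x−h, x]`, the two intermediate points being `≤ 2h` apart).
* **`first_quotient_letter`**, **`second_quotient_letter`** — at spacing `h = 1∕(r·t)` (`0 < r`, `0 < t`), for the samples `p(k) := g(k∕(r·t))` (`k : ℤ`):
  `|t·(p(k+1) − p(k))| ≤ L₁∕r` and `|t²·(2p(k) − p(k+1) − p(k−1))| ≤ 2L₂∕r²` — NO `t` on the right.
HONEST SCOPE.  Calculus only; placing the samples on `Fin (N_μ)` inside one chart (profile vanishing near the chart ends so the wrap-around step is harmless) and
choosing `g` (a `C^{1,1}` bump, e.g. smoothstep ramps: `L₁ = 3∕2`, `L₂ = 6` per unit ramp) are the consumer's; nothing of [B9] asserted.  NOT summit progress (cell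
pub-balaban: NE9 NOT PRINTED ∕ NOT PROVED; «NE9 ⇐ the named binders»; row WALLED ON A MODEL (O-NE9-1; #5 UNRULED); spine PROVED 0∕9; rung (B)+1 finite T⁴ — NOT
infinite volume, NOT mass gap, NOT BetaPertH, NOT Clay).  HONEST DEPENDENCY (cell line): continuum YM on T⁴ ⇐ BetaPertH ∧ nine spine estimates (0/9 proved);
BetaPertH ⇐ (D1) ∧ (D4) ∧ CAP+tail; G-an2-4 gates asym, D1 and NE2/3/4.  NEW file importing Mathlib only; nothing modified.  Net new unproved facts: 0.
-/

namespace Literature.MathematicalPhysics.QuantumFieldTheory.Balaban1983to89.B9Eq343ProfileLetters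

/-- **FIRST DIFFERENCES**: `|g′| ≤ L₁` everywhere ⟹ `|g(y) − g(x)| ≤ L₁·|y − x|`. [folklore] [cite: Balaban1985BackgroundPropagators, (3.43) p.398] -/
theorem abs_sub_le_of_deriv_bound {g g' : ℝ → ℝ} (hg : ∀ x, HasDerivAt g (g' x) x) {L₁ : ℝ} (hL : ∀ x, |g' x| ≤ L₁) (x y : ℝ) :
    |g y - g x| ≤ L₁ * |y - x| := by
  have h := Convex.norm_image_sub_le_of_norm_hasDerivWithin_le (f := g) (f' := g') (s := Set.univ)
    (fun z _ => (hg z).hasDerivWithinAt) (fun z _ => by rw [Real.norm_eq_abs]; exact hL z) convex_univ (Set.mem_univ x) (Set.mem_univ y)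
  rwa [Real.norm_eq_abs, Real.norm_eq_abs] at h

/-- **SECOND DIFFERENCES**: `g′` `L₂`-Lipschitz and `0 < h` ⟹ `|g(x + h) − 2g(x) + g(x − h)| ≤ 2L₂·h²` (mean value theorem on the two intervals; the two
intermediate points are at distance `≤ 2h`). [folklore] [cite: Balaban1985BackgroundPropagators, (3.43) p.398] -/
theorem abs_second_difference_le {g g' : ℝ → ℝ} (hg : ∀ x, HasDerivAt g (g' x) x) {L₂ : ℝ} (hL : ∀ x y, |g' x - g' y| ≤ L₂ * |x - y|)
    (x : ℝ) {h : ℝ} (hh : 0 < h) : |g (x + h) - 2 * g x + g (x - h)| ≤ 2 * L₂ * h ^ 2 := by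
  have hcont : Continuous g := continuous_iff_continuousAt.mpr fun z => (hg z).continuousAt
  -- MVT on [x, x+h]
  obtain ⟨ξ, hξ, hξ'⟩ := exists_hasDerivAt_eq_slope g g' (by linarith : x < x + h) hcont.continuousOn (fun z _ => hg z)
  -- MVT on [x-h, x]
  obtain ⟨ζ, hζ, hζ'⟩ := exists_hasDerivAt_eq_slope g g' (by linarith : x - h < x) hcont.continuousOn (fun z _ => hg z)
  have e1 : g (x + h) - g x = g' ξ * h := by
    rw [hξ', show x + h - x = h by ring, div_mul_cancel₀ _ hh.ne']
  have e2 : g x - g (x - h) = g' ζ * h := by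
    rw [hζ', show x - (x - h) = h by ring, div_mul_cancel₀ _ hh.ne']
  have e : g (x + h) - 2 * g x + g (x - h) = (g' ξ - g' ζ) * h := by linear_combination e1 - e2
  have hdist : |ξ - ζ| ≤ 2 * h := by
    rw [abs_le]; constructor <;> linarith [hξ.1, hξ.2, hζ.1, hζ.2]
  have hL₂ : 0 ≤ L₂ := by
    have h1 := hL (ξ + 1) ξ
    rw [show ξ + 1 - ξ = 1 by ring, abs_one, mul_one] at h1
    exact (abs_nonneg _).trans h1
  rw [e, abs_mul, abs_of_pos hh]
  calc |g' ξ - g' ζ| * h ≤ L₂ * |ξ - ζ| * h := mul_le_mul_of_nonneg_right (hL ξ ζ) hh.le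
    _ ≤ L₂ * (2 * h) * h := mul_le_mul_of_nonneg_right (mul_le_mul_of_nonneg_left hdist hL₂) hh.le
    _ = 2 * L₂ * h ^ 2 := by ring

/-- **THE FIRST DIFFERENCE-QUOTIENT LETTER IS t-FREE**: samples `p(k) = g(k∕(r·t))`, `0 < r`, `0 < t`, `|g′| ≤ L₁` ⟹ `|t·(p(k+1) − p(k))| ≤ L₁∕r`.
[folklore] [cite: Balaban1985BackgroundPropagators, (3.43) p.398, (3.1) p.390] -/
theorem first_quotient_letter {g g' : ℝ → ℝ} (hg : ∀ x, HasDerivAt g (g' x) x) {L₁ : ℝ} (hL : ∀ x, |g' x| ≤ L₁) {r t : ℝ} (hr : 0 < r) (ht : 0 < t)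
    (k : ℤ) : |t * (g (((k + 1 : ℤ) : ℝ) / (r * t)) - g ((k : ℝ) / (r * t)))| ≤ L₁ / r := by
  have hrt : 0 < r * t := mul_pos hr ht
  have h := abs_sub_le_of_deriv_bound hg hL ((k : ℝ) / (r * t)) (((k + 1 : ℤ) : ℝ) / (r * t))
  have hd : |(((k + 1 : ℤ) : ℝ)) / (r * t) - (k : ℝ) / (r * t)| = 1 / (r * t) := by
    push_cast; rw [← sub_div, show (k : ℝ) + 1 - k = 1 by ring, abs_of_pos (by positivity)]
  rw [hd] at h
  rw [abs_mul, abs_of_pos ht]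
  calc t * |g (((k + 1 : ℤ) : ℝ) / (r * t)) - g ((k : ℝ) / (r * t))| ≤ t * (L₁ * (1 / (r * t))) := mul_le_mul_of_nonneg_left h ht.le
    _ = L₁ / r := by field_simp

/-- **THE SECOND DIFFERENCE-QUOTIENT LETTER IS t-FREE**: samples `p(k) = g(k∕(r·t))`, `0 < r`, `0 < t`, `g′` `L₂`-Lipschitz ⟹
`|t²·(2p(k) − p(k+1) − p(k−1))| ≤ 2L₂∕r²`. [folklore] [cite: Balaban1985BackgroundPropagators, (3.43) p.398, (3.1) p.390] -/
theorem second_quotient_letter {g g' : ℝ → ℝ} (hg : ∀ x, HasDerivAt g (g' x) x) {L₂ : ℝ} (hL : ∀ x y, |g' x - g' y| ≤ L₂ * |x - y|) {r t : ℝ}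
    (hr : 0 < r) (ht : 0 < t) (k : ℤ) :
    |t ^ 2 * (2 * g ((k : ℝ) / (r * t)) - g (((k + 1 : ℤ) : ℝ) / (r * t)) - g (((k - 1 : ℤ) : ℝ) / (r * t)))| ≤ 2 * L₂ / r ^ 2 := by
  have hrt : 0 < r * t := mul_pos hr ht
  have hh : 0 < 1 / (r * t) := by positivity
  have h := abs_second_difference_le hg hL ((k : ℝ) / (r * t)) hh
  have e1 : (k : ℝ) / (r * t) + 1 / (r * t) = (((k + 1 : ℤ) : ℝ)) / (r * t) := by push_cast; ring
  have e2 : (k : ℝ) / (r * t) - 1 / (r * t) = (((k - 1 : ℤ) : ℝ)) / (r * t) := by push_cast; ring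
  rw [e1, e2] at h
  have e3 : t ^ 2 * (2 * g ((k : ℝ) / (r * t)) - g (((k + 1 : ℤ) : ℝ) / (r * t)) - g (((k - 1 : ℤ) : ℝ) / (r * t))) =
      -(t ^ 2 * (g (((k + 1 : ℤ) : ℝ) / (r * t)) - 2 * g ((k : ℝ) / (r * t)) + g (((k - 1 : ℤ) : ℝ) / (r * t)))) := by ring
  rw [e3, abs_neg, abs_mul, abs_of_pos (by positivity : 0 < t ^ 2)]
  calc t ^ 2 * |g (((k + 1 : ℤ) : ℝ) / (r * t)) - 2 * g ((k : ℝ) / (r * t)) + g (((k - 1 : ℤ) : ℝ) / (r * t))|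
      ≤ t ^ 2 * (2 * L₂ * (1 / (r * t)) ^ 2) := mul_le_mul_of_nonneg_left h (by positivity)
    _ = 2 * L₂ / r ^ 2 := by field_simp

end Literature.MathematicalPhysics.QuantumFieldTheory.Balaban1983to89.B9Eq343ProfileLetters
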